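import Summits.CriticalPhenomena.PercolationContinuityZ3.Theorems.PercNearOneGluingNoHeavyLowerTailForestRayleighTools
import HarnessLib

/-!
# Weighted forest negative correlation — contraction tools: parallel pairs through a pinned edge

Notation as in `…ForestRayleighTools`: `Z(D;K) = Σ_{G ⊆ D, ⟨G ∪ K⟩ acyclic} ∏ w`,
`(R)(D;K;e,f) : Z(D;K∪{e,f})·Z(D;K) ≤ Z(D;K∪e)·Z(D;K∪f)`.

When an edge `uv` is pinned, the instance is really an instance of the contraction `E/uv`, in which
the two edges `vx`, `ux` at a third vertex `x` become parallel. In the simple-graph language of the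
tree this is expressed by the following surgery facts (all with `uv ∈ K`):

* `forestsW_free_closing`: a free edge whose insertion into the pinned set creates a cycle never
  occurs in a forest — `Z(D ∪ g;K) = Z(D;K)`;
* `forestsW_free_reroute`: a free edge `vx` can be moved to `ux` (fresh) — `Z(D ∪ vx;K) = Z_{w'}(D ∪ ux;K)`,
  `w'(ux) = w(vx)`;
* `forestsW_free_parallel`: two free edges `vx, ux` merge — `Z(D ∪ {vx,ux};K) = Z_{w'}(D ∪ ux;K)`,
  `w'(ux) = w(ux) + w(vx)` (Semple–Welsh's parallel reduction, Prop. 3.7, in pinned form);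
* `lsm_free_parallel_rayleigh`: a free edge `ux` parallel (through `uv`) to the Rayleigh edge `e = vx`
  drops out of `(R)`: `(R)(D ∪ ux;K;e,f) ⟸ (R)(D;K;e,f)` (S–W Prop. 3.7, case `|{b,c} ∩ {e,f}| = 1`).

Together with `forestsW_pin_reroute`, `forestsW_pin_pendant`, `forestsW_eq_zero_of_triangle`
(`…Tools`) these reduce every instance with a pinned edge to an instance of the contracted graph.
Theorems only; no definitions, no `sorry`.
-/

open Finset SimpleGraph
open scoped Classical

namespace Summit.CriticalPhenomena.PercolationContinuityZ3.Theorems.ForestRayleigh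

variable {V : Type*} [Fintype V] [DecidableEq V]

omit [Fintype V] in
/-- **A free edge closing a pinned cycle is never used**: if `⟨K ∪ g⟩` is not acyclic and `g ∉ D`
then `Z(D ∪ g;K) = Z(D;K)`. [elementary] -/
theorem forestsW_free_closing (w : Sym2 V → ℝ) (D K : Finset (Sym2 V)) {g : Sym2 V} (hg : g ∉ D)
    (hK : ¬(fromEdgeSet ((insert g K : Finset (Sym2 V)) : Set (Sym2 V))).IsAcyclic) :
    ∑ G ∈ (insert g D).powerset.filter (fun G =>
        (fromEdgeSet ((G ∪ K : Finset (Sym2 V)) : Set (Sym2 V))).IsAcyclic), ∏ x ∈ G, w x =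
      ∑ G ∈ D.powerset.filter (fun G =>
        (fromEdgeSet ((G ∪ K : Finset (Sym2 V)) : Set (Sym2 V))).IsAcyclic), ∏ x ∈ G, w x := by
  rw [forestsW_insert_split w D K hg, forestsW_eq_zero_of_not_isAcyclic w D (insert g K) hK, mul_zero,
    add_zero]

/-- **Re-routing a free edge through a pinned edge.** If `uv ∈ K`, `vx ∉ D ∪ K`, `ux ∉ D ∪ K`
(`x ≠ u, v`), then `Z(D ∪ vx;K) = Z_{w'}(D ∪ ux;K)` with `w' = w[ux ↦ w(vx)]`. [elementary] -/
theorem forestsW_free_reroute (w : Sym2 V → ℝ) (D K : Finset (Sym2 V))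
    (hDK : ∀ z ∈ D ∪ K, ¬z.IsDiag) {u v x : V} (huv : s(v, u) ∈ K) (hvx : v ≠ x) (hux : u ≠ x)
    (h₁ : s(v, x) ∉ D ∪ K) (h₂ : s(u, x) ∉ D ∪ K) :
    ∑ G ∈ (insert s(v, x) D).powerset.filter (fun G =>
        (fromEdgeSet ((G ∪ K : Finset (Sym2 V)) : Set (Sym2 V))).IsAcyclic), ∏ y ∈ G, w y =
      ∑ G ∈ (insert s(u, x) D).powerset.filter (fun G =>
        (fromEdgeSet ((G ∪ K : Finset (Sym2 V)) : Set (Sym2 V))).IsAcyclic),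
        ∏ y ∈ G, Function.update w s(u, x) (w s(v, x)) y := by
  have h₁D : s(v, x) ∉ D := fun h => h₁ (Finset.mem_union_left _ h)
  have h₂D : s(u, x) ∉ D := fun h => h₂ (Finset.mem_union_left _ h)
  rw [forestsW_insert_split w D K h₁D, forestsW_insert_split _ D K h₂D, forestsW_update w D K _ _ h₂D,
    forestsW_update w D _ _ _ h₂D, Function.update_self, forestsW_pin_reroute w D K hDK huv hvx hux h₁ h₂]

/-- **Merging two free edges made parallel by a pinned edge** (S–W Prop. 3.7, parallel case, pinned
form). If `uv ∈ K` and `vx, ux ∉ D ∪ K` (`x ≠ u, v`), then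
`Z(D ∪ {vx, ux};K) = Z_{w'}(D ∪ ux;K)` with `w' = w[ux ↦ w(ux) + w(vx)]`. [S–W 2008 Prop. 3.7] -/
theorem forestsW_free_parallel (w : Sym2 V → ℝ) (D K : Finset (Sym2 V))
    (hDK : ∀ z ∈ D ∪ K, ¬z.IsDiag) {u v x : V} (huv : s(v, u) ∈ K) (hvx : v ≠ x) (hux : u ≠ x)
    (h₁ : s(v, x) ∉ D ∪ K) (h₂ : s(u, x) ∉ D ∪ K) :
    ∑ G ∈ (insert s(v, x) (insert s(u, x) D)).powerset.filter (fun G =>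
        (fromEdgeSet ((G ∪ K : Finset (Sym2 V)) : Set (Sym2 V))).IsAcyclic), ∏ y ∈ G, w y =
      ∑ G ∈ (insert s(u, x) D).powerset.filter (fun G =>
        (fromEdgeSet ((G ∪ K : Finset (Sym2 V)) : Set (Sym2 V))).IsAcyclic),
        ∏ y ∈ G, Function.update w s(u, x) (w s(u, x) + w s(v, x)) y := by
  have h₁D : s(v, x) ∉ D := fun h => h₁ (Finset.mem_union_left _ h)
  have h₂D : s(u, x) ∉ D := fun h => h₂ (Finset.mem_union_left _ h)
  have hne : s(v, x) ≠ s(u, x) := fun h => by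
    rcases Sym2.eq_iff.1 h with ⟨h, _⟩ | ⟨h, h'⟩
    · exact hDK _ (Finset.mem_union_right _ huv) (Sym2.mk_isDiag_iff.2 h)
    · exact hvx h
  have h₁D' : s(v, x) ∉ insert s(u, x) D := by
    rw [Finset.mem_insert, not_or]; exact ⟨hne, h₁D⟩
  -- the doubly-used term vanishes: `u v x` would be a pinned triangle
  have huvK : s(v, u) ∈ insert s(u, x) (insert s(v, x) K) :=
    Finset.mem_insert_of_mem (Finset.mem_insert_of_mem huv)
  have hKd : ∀ z ∈ insert s(u, x) (insert s(v, x) K), ¬z.IsDiag := by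
    intro z hz
    rcases Finset.mem_insert.1 hz with rfl | hz
    · exact fun h => hux (Sym2.mk_isDiag_iff.1 h)
    rcases Finset.mem_insert.1 hz with rfl | hz
    · exact fun h => hvx (Sym2.mk_isDiag_iff.1 h)
    · exact hDK z (Finset.mem_union_right _ hz)
  have htri := forestsW_eq_zero_of_triangle w D (insert s(u, x) (insert s(v, x) K)) hKd
    (a := v) (b := u) (c := x) huvK (Finset.mem_insert_self _ _)
    (Finset.mem_insert_of_mem (Finset.mem_insert_self _ _))
    (fun h => hDK _ (Finset.mem_union_right _ huv) (Sym2.mk_isDiag_iff.2 h)) hux hvx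
  rw [forestsW_insert_split w _ K h₁D', forestsW_insert_split w D K h₂D,
    forestsW_insert_split w D (insert s(v, x) K) h₂D, htri, mul_zero, add_zero,
    forestsW_pin_reroute w D K hDK huv hvx hux h₁ h₂,
    forestsW_insert_split _ D K h₂D, forestsW_update w D K _ _ h₂D, forestsW_update w D _ _ _ h₂D,
    Function.update_self]
  ring

/-- **A free edge parallel (through a pinned edge) to a Rayleigh edge drops out of `(R)`**
(S–W Prop. 3.7, case `|{b,c} ∩ {e,f}| = 1`, pinned form). With `uv ∈ K`, `e = vx`, `g = ux ∉ D ∪ K`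
fresh, `x ≠ u, v`, `f ≠ g`: `(R)(D;K;e,f)` implies `(R)(D ∪ g;K;e,f)`. [S–W 2008 Prop. 3.7] -/
theorem lsm_free_parallel_rayleigh (w : Sym2 V → ℝ) (hw : ∀ y, 0 ≤ w y) (D K : Finset (Sym2 V))
    (f : Sym2 V) (hDK : ∀ z ∈ D ∪ insert f K, ¬z.IsDiag) {u v x : V} (huv : s(v, u) ∈ K)
    (hvx : v ≠ x) (hux : u ≠ x) (h₁ : s(v, x) ∉ D ∪ insert f K) (h₂ : s(u, x) ∉ D ∪ insert f K)
    (h : (∑ G ∈ D.powerset.filter (fun G =>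
        (fromEdgeSet ((G ∪ (insert s(v, x) (insert f K)) : Finset (Sym2 V)) : Set (Sym2 V))).IsAcyclic), ∏ y ∈ G, w y) *
      (∑ G ∈ D.powerset.filter (fun G =>
        (fromEdgeSet ((G ∪ K : Finset (Sym2 V)) : Set (Sym2 V))).IsAcyclic), ∏ y ∈ G, w y) ≤
    (∑ G ∈ D.powerset.filter (fun G =>
        (fromEdgeSet ((G ∪ (insert s(v, x) K) : Finset (Sym2 V)) : Set (Sym2 V))).IsAcyclic), ∏ y ∈ G, w y) *
      (∑ G ∈ D.powerset.filter (fun G =>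
        (fromEdgeSet ((G ∪ (insert f K) : Finset (Sym2 V)) : Set (Sym2 V))).IsAcyclic), ∏ y ∈ G, w y)) :
    (∑ G ∈ (insert s(u, x) D).powerset.filter (fun G =>
        (fromEdgeSet ((G ∪ (insert s(v, x) (insert f K)) : Finset (Sym2 V)) : Set (Sym2 V))).IsAcyclic), ∏ y ∈ G, w y) *
      (∑ G ∈ (insert s(u, x) D).powerset.filter (fun G =>
        (fromEdgeSet ((G ∪ K : Finset (Sym2 V)) : Set (Sym2 V))).IsAcyclic), ∏ y ∈ G, w y) ≤
    (∑ G ∈ (insert s(u, x) D).powerset.filter (fun G =>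
        (fromEdgeSet ((G ∪ (insert s(v, x) K) : Finset (Sym2 V)) : Set (Sym2 V))).IsAcyclic), ∏ y ∈ G, w y) *
      (∑ G ∈ (insert s(u, x) D).powerset.filter (fun G =>
        (fromEdgeSet ((G ∪ (insert f K) : Finset (Sym2 V)) : Set (Sym2 V))).IsAcyclic), ∏ y ∈ G, w y) := by
  have h₂D : s(u, x) ∉ D := fun hh => h₂ (Finset.mem_union_left _ hh)
  have hvu : v ≠ u := fun hh => hDK _ (Finset.mem_union_right _ (Finset.mem_insert_of_mem huv))
    (Sym2.mk_isDiag_iff.2 hh)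
  have hDK₀ : ∀ z ∈ D ∪ K, ¬z.IsDiag := fun z hz => hDK z (by
    rcases Finset.mem_union.1 hz with hz | hz
    · exact Finset.mem_union_left _ hz
    · exact Finset.mem_union_right _ (Finset.mem_insert_of_mem hz))
  -- with `e = vx` pinned, `g = ux` would close the triangle `u v x`
  have htri : ∀ K' : Finset (Sym2 V), K ⊆ K' → (∀ z ∈ K', ¬z.IsDiag) →
      ¬(fromEdgeSet ((insert s(u, x) (insert s(v, x) K') : Finset (Sym2 V)) : Set (Sym2 V))).IsAcyclic := by
    intro K' hKK' hK'
    refine not_isAcyclic_of_triangle (a := v) (b := u) (c := x) ?_ ?_ ?_ ?_ hvu hux hvx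
    · intro z hz
      rcases Finset.mem_insert.1 hz with rfl | hz
      · exact fun hh => hux (Sym2.mk_isDiag_iff.1 hh)
      rcases Finset.mem_insert.1 hz with rfl | hz
      · exact fun hh => hvx (Sym2.mk_isDiag_iff.1 hh)
      · exact hK' z hz
    · exact Finset.mem_insert_of_mem (Finset.mem_insert_of_mem (hKK' huv))
    · exact Finset.mem_insert_self _ _
    · exact Finset.mem_insert_of_mem (Finset.mem_insert_self _ _)
  have hKd : ∀ z ∈ K, ¬z.IsDiag := fun z hz => hDK₀ z (Finset.mem_union_right _ hz)
  have hfKd : ∀ z ∈ insert f K, ¬z.IsDiag := fun z hz => hDK z (Finset.mem_union_right _ hz)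
  -- the four terms of the instance with `g`
  rw [forestsW_free_closing w D (insert s(v, x) (insert f K)) h₂D
      (htri (insert f K) (Finset.subset_insert _ _) hfKd),
    forestsW_free_closing w D (insert s(v, x) K) h₂D (htri K subset_rfl hKd),
    forestsW_insert_split w D K h₂D, forestsW_insert_split w D (insert f K) h₂D,
    forestsW_pin_reroute w D K hDK₀ (v := u) (u₁ := v) (u₂ := x) (by rw [Sym2.eq_swap]; exact huv) hux
      hvx (fun hh => h₂ (by
        rcases Finset.mem_union.1 hh with hh | hh
        · exact Finset.mem_union_left _ hh
        · exact Finset.mem_union_right _ (Finset.mem_insert_of_mem hh)))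
      (fun hh => h₁ (by
        rcases Finset.mem_union.1 hh with hh | hh
        · exact Finset.mem_union_left _ hh
        · exact Finset.mem_union_right _ (Finset.mem_insert_of_mem hh))),
    forestsW_pin_reroute w D (insert f K) hDK (v := u) (u₁ := v) (u₂ := x)
      (by rw [Sym2.eq_swap]; exact Finset.mem_insert_of_mem huv) hux hvx h₂ h₁]
  have hg : 0 ≤ w s(u, x) := hw _
  have hA := forestsW_nonneg w hw D (insert s(v, x) (insert f K))
  have hC := forestsW_nonneg w hw D (insert s(v, x) K)
  nlinarith [h, mul_nonneg hg (mul_nonneg hA hC)]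

end Summit.CriticalPhenomena.PercolationContinuityZ3.Theorems.ForestRayleigh
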